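import Literature.AnabelianGeometry.SemiGraphs.TemperedPiTreesTrans
import Literature.AnabelianGeometry.SemiGraphs.TemperedLevelData
import HarnessLib

/-!
# The level data of [SemiAnbd] Thm 3.7 (iii) from a Galois tower, modulo the identifications

Mochizuki, *Semi-graphs of anabelioids*, Publ. RIMS **42** (2006), §3, proof of Thm. 3.7 (iii),
author's manuscript p. 41 [cite: MochizukiSemiAnbd2006, Thm 3.7(iii) p.41] ("`H ⊆ π₁^temp(𝒢)` … acts
continuously on the semi-graph `𝒢_{∞,i}` … this action factors through a finite quotient … the action
of `H` is over `𝒢` … Since the semi-graphs `𝔾_j` are all finite …"), read with the author's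
*Comments* (2020), item (6) (HOME/lit/SemiAnbd-Comments-2020.txt).

ASSEMBLY (no new mathematics): for Galois level data `D` (abc-iut-L3-t9's `GaloisLevelData`, tower
`S n` with `D.temperedPi = lim_n Aut(𝒢_{∞,S n})`), a chart `c : TemperedPiChart 𝒢` whose group maps
continuously to `D.temperedPi` (`ρ`; the identity for the constructed chart), connected levels
(`hconn`) and a FINITE `𝔾` with finite levels (cell ruling φ2), the files `TemperedPiTrees(Trans).lean`
fill EVERY tree / finite-level field of `VerticialLevelData` / `FiniteLevelData`
(`TemperedLevelData.lean`): `GaloisLevelData.verticialLevelDataOfTower`,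
`GaloisLevelData.finiteLevelDataOfTower`.  What is taken as INPUT, verbatim in the shapes of the
structure fields instantiated at these trees, is exactly the anabelioid content still owed by the
producer rows: (I1) `fix`, (I2) `stab`, (I3) `edge`, (I4′) `stabBranchPair'`.  Seat abc-iut-L3-t6
(row «P-TREE», assembly). Nothing here bears on [IUTchIII] Cor. 3.12.
-/

namespace Literature.AnabelianGeometry.SemiGraphs

namespace ProfiniteSemiGraph

namespace GaloisLevelData

open CategoryTheory Topology

universe u

variable {𝒢 : ProfiniteSemiGraph.{u}} (D : GaloisLevelData 𝒢) (h𝒢 : 𝒢.IsCountable)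
  (c : TemperedPiChart 𝒢) (ρ : c.G →* D.temperedPi h𝒢)

/-- The kernel of the action of the chart group on `𝔾̃_n` through `ρ : c.G → π₁^temp = lim Aut(𝒢_{∞,n})`
is open ("this action factors through a finite quotient", p. 41). [cite: MochizukiSemiAnbd2006, Thm 3.7(iii) p.41] -/
theorem isOpen_ker_treeAct_comp (hρ : Continuous ρ) (n : ℕ) :
    IsOpen (((D.treeAct h𝒢 n).comp ρ).ker : Set c.G) := by
  rw [← MonoidHom.comap_ker, Subgroup.coe_comap]
  exact (D.isOpen_ker_treeAct h𝒢 n).preimage hρ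

/-- **The tree-level data `VerticialLevelData` of Thm. 3.7 (iii) from a Galois tower**, modulo the
identifications (I1) `fix`, (I2) `stab`, (I3) `edge` taken as inputs (stated for the trees `𝔾̃_n` of
the tower with the action through `ρ`); every other field is supplied by `TemperedPiTrees(Trans).lean`.
[cite: MochizukiSemiAnbd2006, Thm 3.7(iii) p.41] -/
noncomputable def verticialLevelDataOfTower (hρ : Continuous ρ)
    (fix : ∀ (v : 𝒢.graph.Vertex) (H : Subgroup c.G), H ∈ verticialSubgroups c v →
      ∃ x : ∀ n, (D.tree n).Vertex, (∀ ⦃i j : ℕ⦄ (h : i ≤ j), (D.treeTrans h).vertexMap (x j) = x i) ∧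
        ∀ g ∈ H, ∀ n, (D.treeAct h𝒢 n (ρ g)).hom.vertexMap (x n) = x n)
    (stab : ∀ x : ∀ n, (D.tree n).Vertex,
      (∀ ⦃i j : ℕ⦄ (h : i ≤ j), (D.treeTrans h).vertexMap (x j) = x i) →
        ∃ (v : 𝒢.graph.Vertex) (H : Subgroup c.G), H ∈ verticialSubgroups c v ∧
          ∀ g : c.G, (∀ n, (D.treeAct h𝒢 n (ρ g)).hom.vertexMap (x n) = x n) → g ∈ H)
    (edge : ∀ (j₁ : ℕ) (ε : ∀ j : {j : ℕ // j₁ ≤ j}, (D.tree j.1).Edge),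
      (∀ ⦃i j : {j : ℕ // j₁ ≤ j}⦄ (h : i.1 ≤ j.1), (D.treeTrans h).edgeMap (ε j) = ε i) →
        ∃ (e : 𝒢.graph.Edge) (L : Subgroup c.G), L ∈ edgeLikeSubgroups c e ∧
          (∀ j, (D.treeProj j.1).edgeMap (ε j) = e) ∧
          ∀ g : c.G, (∀ j, (D.treeAct h𝒢 j.1 (ρ g)).hom.edgeMap (ε j) = ε j ∧
            ∀ b : (D.tree j.1).Branch, (D.tree j.1).edgeOf b = ε j →
              (D.treeAct h𝒢 j.1 (ρ g)).hom.branchMap b = b) → g ∈ L) :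
    VerticialLevelData.{0} 𝒢 c where
  J := ℕ
  tree := D.tree
  isTree := D.isTree_tree
  vertex := D.treeVertex
  proj := D.treeProj
  act n := (D.treeAct h𝒢 n).comp ρ
  isOpen_ker n := D.isOpen_ker_treeAct_comp h𝒢 c ρ hρ n
  act_over n g := D.treeAct_over h𝒢 n (ρ g)
  trans _ _ h := D.treeTrans h
  trans_id := D.treeTrans_self
  trans_comp _ _ _ hij hjk := D.treeTrans_comp hij hjk
  trans_over _ _ h := D.treeTrans_over h
  trans_act _ _ h g := D.treeTrans_act h𝒢 h (ρ g)
  fix := fix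
  stab := stab
  edge := edge

variable (hconn : ∀ (n : ℕ) (p q : (D.S n).Point), (D.S n).SameComponent p q)
  [Finite 𝒢.graph.Vertex] [Finite 𝒢.graph.Edge] (hfin : ∀ n, (D.S n).IsFinite)

/-- **The finite-level data `FiniteLevelData` of Thm. 3.7 (iii) from a Galois tower** (finite `𝔾`,
finite connected levels), modulo (I1)–(I3) and the branch-level identification (I4′) `stabBranchPair'`
taken as inputs; the trees, their actions and transitions, the finite levels `𝔾_{S n}`, the
graph-coverings `𝔾̃_n → 𝔾_{S n}`, the level actions and all compatibility squares are supplied by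
`TemperedPiTrees(Trans).lean`. [cite: MochizukiSemiAnbd2006, Thm 3.7(iii) p.41] -/
noncomputable def finiteLevelDataOfTower (hρ : Continuous ρ)
    (fix : ∀ (v : 𝒢.graph.Vertex) (H : Subgroup c.G), H ∈ verticialSubgroups c v →
      ∃ x : ∀ n, (D.tree n).Vertex, (∀ ⦃i j : ℕ⦄ (h : i ≤ j), (D.treeTrans h).vertexMap (x j) = x i) ∧
        ∀ g ∈ H, ∀ n, (D.treeAct h𝒢 n (ρ g)).hom.vertexMap (x n) = x n)
    (stab : ∀ x : ∀ n, (D.tree n).Vertex,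
      (∀ ⦃i j : ℕ⦄ (h : i ≤ j), (D.treeTrans h).vertexMap (x j) = x i) →
        ∃ (v : 𝒢.graph.Vertex) (H : Subgroup c.G), H ∈ verticialSubgroups c v ∧
          ∀ g : c.G, (∀ n, (D.treeAct h𝒢 n (ρ g)).hom.vertexMap (x n) = x n) → g ∈ H)
    (edge : ∀ (j₁ : ℕ) (ε : ∀ j : {j : ℕ // j₁ ≤ j}, (D.tree j.1).Edge),
      (∀ ⦃i j : {j : ℕ // j₁ ≤ j}⦄ (h : i.1 ≤ j.1), (D.treeTrans h).edgeMap (ε j) = ε i) →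
        ∃ (e : 𝒢.graph.Edge) (L : Subgroup c.G), L ∈ edgeLikeSubgroups c e ∧
          (∀ j, (D.treeProj j.1).edgeMap (ε j) = e) ∧
          ∀ g : c.G, (∀ j, (D.treeAct h𝒢 j.1 (ρ g)).hom.edgeMap (ε j) = ε j ∧
            ∀ b : (D.tree j.1).Branch, (D.tree j.1).edgeOf b = ε j →
              (D.treeAct h𝒢 j.1 (ρ g)).hom.branchMap b = b) → g ∈ L)
    (stabBranchPair' : ∀ (j₀ : ℕ) (w : ∀ i : {i : ℕ // j₀ ≤ i}, (D.S i.1).orbitGraph.Vertex)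
      (β β' : ∀ i : {i : ℕ // j₀ ≤ i}, (D.S i.1).orbitGraph.Branch),
      (∀ i, β i ≠ β' i ∧ (D.S i.1).orbitGraph.abuts (β i) = some (w i) ∧
        (D.S i.1).orbitGraph.abuts (β' i) = some (w i)) →
      (∀ ⦃i i' : {i : ℕ // j₀ ≤ i}⦄ (h : i.1 ≤ i'.1), (D.levelTrans h).vertexMap (w i') = w i ∧
        (D.levelTrans h).branchMap (β i') = β i ∧ (D.levelTrans h).branchMap (β' i') = β' i) →
      ∃ (Q : Type u) (_ : Group Q) (ιQ : c.G →* Q) (v : 𝒢.graph.Vertex) (b b' : 𝒢.graph.Branch)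
        (hb : 𝒢.graph.abuts b = some v) (hb' : 𝒢.graph.abuts b' = some v) (ψ : 𝒢.Gv v →* Q)
        (x x' : 𝒢.Gv v),
        Function.Injective ιQ ∧ Function.Injective ψ ∧ (b' ≠ b ∨ x⁻¹ * x' ∉ 𝒢.branchSubgroup b v hb) ∧
        ∀ g : c.G, (∀ i, (D.levelAct h𝒢 hconn i.1 (ρ g)).hom.vertexMap (w i) = w i ∧
          (D.levelAct h𝒢 hconn i.1 (ρ g)).hom.branchMap (β i) = β i ∧
          (D.levelAct h𝒢 hconn i.1 (ρ g)).hom.branchMap (β' i) = β' i) →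
          ιQ g ∈ ((𝒢.branchSubgroup b v hb).map (MulAut.conj x).toMonoidHom).map ψ ⊓
            ((𝒢.branchSubgroup b' v hb').map (MulAut.conj x').toMonoidHom).map ψ) :
    FiniteLevelData.{0} 𝒢 c :=
  FiniteLevelData.mk (toVerticialLevelData := D.verticialLevelDataOfTower h𝒢 c ρ hρ fix stab edge)
    (level := fun n => (D.S n).orbitGraph)
    (finiteVertex := fun n => D.finite_levelVertex n (hfin n))
    (finiteBranch := fun n => D.finite_levelBranch n (hfin n))
    (quot := D.treeQuot)
    (quot_isImmersion := D.treeQuot_isImmersion)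
    (levelAct := fun n => (D.levelAct h𝒢 hconn n).comp ρ)
    (act_quot := fun n g => D.treeQuot_act h𝒢 hconn n (ρ g))
    (levelTrans := fun _ _ h => D.levelTrans h)
    (levelTrans_id := D.levelTrans_self)
    (levelTrans_comp := fun _ _ _ hij hjk => D.levelTrans_comp hij hjk)
    (levelTrans_act := fun _ _ h g => D.levelTrans_act h𝒢 hconn h (ρ g))
    (trans_quot := fun _ _ h => D.treeTrans_quot h)
    (stabBranchPair' := stabBranchPair')

end GaloisLevelData

end ProfiniteSemiGraph

end Literature.AnabelianGeometry.SemiGraphs
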